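import Summits.HodgeConjecture.CorCM.Census.DecicWeil23PairCyclic
import Summits.HodgeConjecture.CorCM.DecicWeil23PairTwoTransitiveFamilyHodgeOfMarkman
import HarnessLib

/-!
# COR-CM — ONE `(2,3)`-type over ANY decic CM field `K ⊇ i(k)`: the Hodge conjecture for every product of copies `E^a × B^n`
# GIVEN ONLY Markman's hyperbolic-sixfold theorem and ONE automorphism of `ℂ` permuting the five embeddings over `τ` CYCLICALLY

Cell `pub-hodgecm2` (COR-CM), seat b30 gen 23 (2026-08-22); count-neutral own lane DECIC-2T, part 3 («DECIC-C5-ANY»).  Theorems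
only; no definition, no named fact, no `sorry`.  HONEST FRAMING: CONDITIONAL on the single displayed named fact
`HodgeTheory.Markman2025_weilClasses_algebraic_hyperbolicSixfold` (E. Markman, arXiv:2502.03415 Thm 1.5.1 — UNREFEREED); `HC_CM`
is not asserted and no case of the Hodge conjecture is claimed unconditionally.

WHAT IS NEW.  For ONE fivefold `B ⊨ (K; Φ)` of `k`-signature `(2,3)` the balanced weights of `E^a × B^n` are governed by the
powers of a single realised `5`-cycle: the one-type defect law holds under every Sylow `5`-subgroup of `Sym(5)`
(`Census/DecicWeil23PairCyclic`).  Every transitive permutation group of prime degree `5` contains a `5`-cycle, so the hypothesis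
«some automorphism of `ℂ` permutes the five embeddings of `K` over `τ` cyclically» (`hC5`) holds for EVERY decic CM field
`K ⊇ i(k)` as soon as `Aut(ℂ/k)` is transitive on them (it is: `K` is a field) — it replaces both the `2`-transitivity of
`hodgeConjectureFor_biproduct_comp_vec₂_of_markmanD_h2T` (quintic part `S₅`, `A₅`, `F₂₀`) and the Galois-cyclic frame of seat b09's
`DecicCurveFivefold*` (quintic part `C₅`), and covers the dihedral quintic part `D₅` as well.
* §1 `conj_mem_realisedPerms_of_enum` — an enumeration `x` of the `τ`-fibre moved by an automorphism along a permutation `f`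
  yields the realised permutation `g f g⁻¹` (`g` = the labels of `x` in the frame); `one_/pow_mem_realisedPerms`.
* §2 `modelBalancedD_of_isGaloisBalancedAlg_cyclic` — for products of copies avoiding the second fivefold slot, a realised
  conjugate of the rotation `ρ₀` makes every Galois-balanced weight `A₅`-balanced (`exists_dihedral_conj`, `dihPerm_rot_eq_pow`,
  `modelBalancedD_of_modelBalancedP_cyclic`); §3 the frame form `…_of_frameD_of_markmanSixfold_cyclic`.
* §4 **`hodgeConjectureFor_biproduct_comp_vec₂_of_markmanD_cyclic`** — `K ⊇ i(k)` ANY CM field of degree `10`, `B ⊨ (K; Φ)` ANY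
  CM abelian fivefold of `k`-signature `(2,3)`, `E ⊨ (k; Ψ ∋ τ)`, `hC5`: HC for every `⨁_j ![E, B](κ j)` = every `E^a × B^n`;
  `AVDominatedBy` and family forms (all realisations of one type, e.g. `B` and its Galois conjugates of the same type).
[cite: Markman2025SecantWeil, Thm 1.5.1] [cite: Pohlmann1968, Thm 1] [cite: Shimura1998, §6.2 Thm. 3 and §18.2 Lemma (i)]
[cite: DixonMortimer1996, §2.1] [cite: MumfordAV1970, §19]

## References
* [Markman2025SecantWeil] E. Markman, arXiv:2502.03415 (unrefereed), Thm 1.5.1.  [Pohlmann1968] H. Pohlmann, Ann. of Math. 88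
  (1968), Thm 1.  [Shimura1998] G. Shimura, *Abelian varieties with CM and modular functions*, §6.2 Thm. 3, §18.2 Lemma (i).
  [DixonMortimer1996] J. D. Dixon, B. Mortimer, *Permutation Groups*, GTM 163 (1996), §2.1.  [MumfordAV1970] D. Mumford, *Abelian
  Varieties*, §19.
-/

noncomputable section

open CategoryTheory CategoryTheory.Limits NumberField

namespace Summit.HodgeConjecture.CorCM.DecicWeil23Pair

open Literature.AlgebraicGeometry Literature.AlgebraicGeometry.Motives Literature.AlgebraicGeometry.HodgeTheory
open Literature.AlgebraicGeometry.ComplexMultiplication (IsCMTypeRealisation exists_isCMTypeRealisation)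
open Literature.AlgebraicGeometry.Pohlmann1968
open Literature.AlgebraicTopology.SingularHomology
open Literature.NumberTheory.ComplexMultiplication
open Summit.HodgeConjecture.CorCM.Census.DecicWeil23Pair (PtD inPos ModelBalancedD ModelBalancedP dihPerm cyclicPerms
  mem_cyclicPerms exists_dihedral_conj dihPerm_rot_eq_pow modelBalancedD_of_modelBalancedP_cyclic)
open Summit.HodgeConjecture.CorCM.OcticCurveFourfold (exists_delta_of_mem)
open Summit.HodgeConjecture.CorCM.Domination (AVDominatedBy)
open Summit.HodgeConjecture.CorCM.AndreRiemann (sumFam avDominatedBy_prod_of_biproduct avDominatedBy_biproduct_reindex)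

open scoped Classical

/-! ## §1 Realised conjugates from an enumeration of the fibre -/

section Enum

variable {F k : Type} [Field F] [Field k] {e : (F →+* ℂ) ≃ Fin 5 × Bool} {τ : k →+* ℂ} {i : k →+* F}

/-- `1` is realised (by the identity of `ℂ`). [folklore] -/
theorem one_mem_realisedPerms (e : (F →+* ℂ) ≃ Fin 5 × Bool) : (1 : Equiv.Perm (Fin 5)) ∈ realisedPerms e :=
  (mem_realisedPerms e 1).2 ⟨RingEquiv.refl ℂ, fun a => by
    rw [RingEquiv.coe_ringHom_refl, RingHom.id_comp, Equiv.Perm.one_apply]⟩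

/-- Powers of realised permutations are realised. [folklore] -/
theorem pow_mem_realisedPerms {π : Equiv.Perm (Fin 5)} (h : π ∈ realisedPerms e) : ∀ n : ℕ, π ^ n ∈ realisedPerms e
  | 0 => by rw [pow_zero]; exact one_mem_realisedPerms e
  | n + 1 => by rw [pow_succ]; exact mul_mem_realisedPerms e _ (pow_mem_realisedPerms h n) _ h

/-- The standard rotation `ρ₀ = dihPerm 0 1` is `l ↦ l + 1`. [folklore] -/
theorem dihPerm_zero_one_apply : ∀ l : Fin 5, dihPerm 0 1 l = l + 1 := by
  decide +kernel

/-- The standard reflection `r₀ = dihPerm 0 5` is `l ↦ −l`. [folklore] -/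
theorem dihPerm_zero_five_apply : ∀ l : Fin 5, dihPerm 0 5 l = -l := by
  decide +kernel

/-- **An enumeration of the `τ`-fibre moved along a permutation gives a realised conjugate.**  If `x : Fin 5 ↪ {s | s ∘ i = τ}`
enumerates the embeddings over `τ` and an automorphism `ρ` of `ℂ` acts on them by `ρ ∘ x_l = x_{f l}`, then, with `g` the
labels of `x` in the frame `e`, the permutation `g f g⁻¹` is realised. [cite: Shimura1998, §18.2 Lemma (i)] -/
theorem conj_mem_realisedPerms_of_enum (he_sign : ∀ s : F →+* ℂ, (e s).2 = true ↔ s.comp i = τ)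
    (x : Fin 5 ↪ {s : F →+* ℂ // s.comp i = τ}) {f : Equiv.Perm (Fin 5)} {ρ : ℂ ≃+* ℂ}
    (hρ : ∀ l : Fin 5, (ρ : ℂ →+* ℂ).comp (x l).1 = (x (f l)).1) :
    ∃ g : Equiv.Perm (Fin 5), (∀ l : Fin 5, e.symm (g l, true) = (x l).1) ∧ g * f * g⁻¹ ∈ realisedPerms e := by
  -- the labels of the enumeration
  have htrue : ∀ l : Fin 5, (e (x l).1).2 = true := fun l => (he_sign _).2 (x l).2
  have hlab : ∀ l : Fin 5, e.symm ((e (x l).1).1, true) = (x l).1 := fun l => by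
    rw [show ((e (x l).1).1, true) = e (x l).1 from Prod.ext rfl (htrue l).symm, Equiv.symm_apply_apply]
  have hinj : Function.Injective fun l : Fin 5 => (e (x l).1).1 := fun l l' h => by
    have h' : (x l).1 = (x l').1 := by rw [← hlab l, ← hlab l', show (e (x l).1).1 = (e (x l').1).1 from h]
    exact x.injective (Subtype.ext h')
  let g : Equiv.Perm (Fin 5) := Equiv.ofBijective (fun l => (e (x l).1).1) (Finite.injective_iff_bijective.1 hinj)
  have hg : ∀ l, g l = (e (x l).1).1 := fun _ => rfl
  refine ⟨g, fun l => by rw [hg, hlab], (mem_realisedPerms e _).2 ⟨ρ, fun a => ?_⟩⟩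
  obtain ⟨l, rfl⟩ := g.surjective a
  rw [Equiv.Perm.mul_apply, Equiv.Perm.mul_apply, show g⁻¹ (g l) = l from g.symm_apply_apply l, hg, hlab, hρ, hg, hlab]

end Enum

/-! ## §2 Frame transfer for one-type products: a realised `5`-cycle suffices -/

section Transfer

variable {I : Type} {Kf : I → Type} [∀ i, Field (Kf i)]
  {i₀ i₁ : I} {e : (Kf i₁ →+* ℂ) ≃ Fin 5 × Bool} {τ : Kf i₀ →+* ℂ}
  (hττ : ComplexEmbedding.conjugate τ ≠ τ) (hk : ∀ σ : Kf i₀ →+* ℂ, σ = τ ∨ σ = ComplexEmbedding.conjugate τ)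
  {i : Kf i₀ →+* Kf i₁}
  (he_sign : ∀ s : Kf i₁ →+* ℂ, (e s).2 = true ↔ s.comp i = τ)
  (he_conj : ∀ s : Kf i₁ →+* ℂ, e (ComplexEmbedding.conjugate s) = ((e s).1, !(e s).2))
  {c : Bool} {Φ₃ : ∀ j : Fin 3, CMType (Kf (pairSlots i₀ i₁ j))}
  (hΦ : ∀ (m : Fin 2) (s : Kf i₁ →+* ℂ), s ∈ (Φ₃ m.succ).1 ↔ (e s).2 = inPos c m (e s).1)
  (hΨ : ∀ σ : Kf i₀ →+* ℂ, σ ∈ (Φ₃ 0).1 ↔ σ = τ)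
  {N : ℕ} (κ : Fin N → Fin 3)

/-- Products of copies avoiding the third slot have no model points on the second fivefold slot. [folklore] -/
theorem toPtD_ne_inr_one (hκ : ∀ j, κ j ≠ 2) (x : (j : Fin N) × (Kf (pairSlots i₀ i₁ (κ j)) →+* ℂ)) (a : Fin 5) (b : Bool) :
    toPtD e τ ((Sigma.map κ (fun _ => id) :
      ((j : Fin N) × (Kf (pairSlots i₀ i₁ (κ j)) →+* ℂ)) → ((m : Fin 3) × (Kf (pairSlots i₀ i₁ m) →+* ℂ))) x) ≠
      Sum.inr (1, (a, b)) := by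
  intro h
  rcases sigma_casesD (⟨κ x.1, x.2⟩ : (m : Fin 3) × (Kf (pairSlots i₀ i₁ m) →+* ℂ)) with ⟨σ, hσ⟩ | ⟨m, s, hms⟩
  · have h' := h
    change toPtD e τ ⟨κ x.1, x.2⟩ = _ at h'
    rw [hσ, toPtD_zero] at h'
    exact Sum.inl_ne_inr h'
  · have h' := h
    change toPtD e τ ⟨κ x.1, x.2⟩ = _ at h'
    rw [hms, toPtD_succ, Sum.inr.injEq, Prod.mk.injEq] at h'
    have hm : κ x.1 = m.succ := congrArg Sigma.fst hms
    rw [h'.1] at hm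
    exact hκ x.1 hm

include hττ hk he_sign he_conj hΦ hΨ in
/-- **FRAME TRANSFER for one-type products under a realised `5`-cycle**: if a conjugate `g ρ₀ g⁻¹` of the standard rotation
of the pairs is realised by an automorphism of `ℂ`, every `Aut(ℂ)`-balanced weight of a product of copies of `E = A₃ 0` and
`B = A₃ 1` (slot map `κ` avoiding `2`) satisfies ALL SIXTY `A₅`-equations `ModelBalancedD` (the realised powers of the `5`-cycle form
a Sylow `5`-subgroup `P_j`; one-type defect law). [cite: GaoUllmo2025, Thm 3.1 (3.2)] [cite: Pohlmann1968, Thm 1] -/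
theorem modelBalancedD_of_isGaloisBalancedAlg_cyclic [NumberField (Kf i₁)] [IsCMField (Kf i₁)] (hκ : ∀ j, κ j ≠ 2)
    {g : Equiv.Perm (Fin 5)} (hrot : g * dihPerm 0 1 * g⁻¹ ∈ realisedPerms e)
    {S : Finset ((j : Fin N) × (Kf (pairSlots i₀ i₁ (κ j)) →+* ℂ))}
    (hS : IsGaloisBalancedAlg (K := fun j => Kf (pairSlots i₀ i₁ (κ j))) (fun j => Φ₃ (κ j)) S) :
    ModelBalancedD c (fun x => toPtD e τ ((Sigma.map κ (fun _ => id) :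
      ((j : Fin N) × (Kf (pairSlots i₀ i₁ (κ j)) →+* ℂ)) → ((m : Fin 3) × (Kf (pairSlots i₀ i₁ m) →+* ℂ))) x)) S := by
  obtain ⟨j, ⟨a, ha⟩, -⟩ := exists_dihedral_conj g
  have hsub : ∀ π ∈ cyclicPerms j, π ∈ realisedPerms e := by
    intro π hπ
    obtain ⟨t, ht, rfl⟩ := mem_cyclicPerms.1 hπ
    obtain ⟨n, hn⟩ := dihPerm_rot_eq_pow j a t ht
    rw [hn, ← ha]
    exact pow_mem_realisedPerms hrot _
  have hP := modelBalancedP_of_isGaloisBalancedAlg hττ hk he_sign he_conj hΦ hΨ κ hS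
  exact modelBalancedD_of_modelBalancedP_cyclic j (fun x _ a b => toPtD_ne_inr_one κ hκ x a b)
    fun π hπ => hP π (hsub π hπ)

end Transfer

/-! ## §3 The frame form -/

section Assembly

variable {I : Type} {Kf : I → Type} [∀ i, Field (Kf i)] [∀ i, NumberField (Kf i)] [∀ i, IsCMField (Kf i)]
  {i₀ i₁ : I} {τ : Kf i₀ →+* ℂ} {i : Kf i₀ →+* Kf i₁} {c : Bool}
  {A₃ : Fin 3 → AbelianVariety ℂ} {Φ₃ : ∀ j : Fin 3, CMType (Kf (pairSlots i₀ i₁ j))}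
  {ι₃ : ∀ j, 𝓞 (Kf (pairSlots i₀ i₁ j)) →+* End (A₃ j)}
  {θ₃ : ∀ j, Kf (pairSlots i₀ i₁ j) →+* Module.End ℂ (complexBetti (A₃ j).X 1)}

/-- **MAIN THEOREM (frame form, ONE type, realised `5`-cycle).**  For `E = A₃ 0 ⊨ (k; {τ})`, `B = A₃ 1 ⊨ (K; Φ₀)` a CM fivefold
of `k`-signature `(2,3)` over a decic `K ⊇ i(k)` (a second type in slot `2` only fixes the frame's normal form and is never used:
`κ` avoids `2`), and a realised conjugate of the rotation of the five pairs (`hrot`): the Hodge conjecture for every `⨁_j A₃(κ j)`,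
GIVEN ONLY Markman's sixfold theorem. [cite: Markman2025SecantWeil, Thm 1.5.1] [cite: Pohlmann1968, Thm 1] -/
theorem hodgeConjectureFor_biproduct_comp_of_frameD_of_markmanSixfold_cyclic
    (hM6 : Markman2025_weilClasses_algebraic_hyperbolicSixfold)
    {N : ℕ} (κ : Fin N → Fin 3) (hκ : ∀ j, κ j ≠ 2) (h10 : Module.finrank ℚ (Kf i₁) = 10)
    (h2 : Module.finrank ℚ (Kf i₀) = 2) (i : Kf i₀ →+* Kf i₁)
    {δ : 𝓞 (Kf i₀)} {d : ℕ} (hd : 0 < d) (hδ : ((δ : Kf i₀)) ^ 2 = -(d : Kf i₀))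
    (hτ : τ (δ : Kf i₀) = Complex.I * (Real.sqrt d : ℂ))
    (hA : ∀ j, IsCMTypeRealisation (Φ₃ j) (A₃ j) (ι₃ j) (θ₃ j))
    (e : (Kf i₁ →+* ℂ) ≃ Fin 5 × Bool)
    (he_sign : ∀ s : Kf i₁ →+* ℂ, (e s).2 = true ↔ s.comp i = τ)
    (he_conj : ∀ s : Kf i₁ →+* ℂ, e (ComplexEmbedding.conjugate s) = ((e s).1, !(e s).2))
    (hΦ : ∀ (m : Fin 2) (s : Kf i₁ →+* ℂ), s ∈ (Φ₃ m.succ).1 ↔ (e s).2 = inPos c m (e s).1)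
    (hΨ : ∀ σ : Kf i₀ →+* ℂ, σ ∈ (Φ₃ 0).1 ↔ σ = τ)
    {g : Equiv.Perm (Fin 5)} (hrot : g * dihPerm 0 1 * g⁻¹ ∈ realisedPerms e) :
    HodgeConjectureFor (⨁ fun j => A₃ (κ j)).dim (⨁ fun j => A₃ (κ j)).X :=
  hodgeConjectureFor_biproduct_comp_of_frameD_of_markmanSixfold_of_transfer hM6 κ h10 h2 i hd hδ hτ hA e he_sign he_conj hΦ hΨ
    fun _ hS => modelBalancedD_of_isGaloisBalancedAlg_cyclic (QuarticCM.conjugate_ne τ)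
      (fun σ => QuarticCM.eq_or_eq_conjugate_of_quadratic h2 τ σ) he_sign he_conj hΦ hΨ κ hκ hrot hS

end Assembly

/-! ## §4 The intrinsic one-type theorem over ANY decic CM field -/

section Main

variable {K : Type} [Field K] [NumberField K] [IsCMField K] {k : Type} [Field k] [NumberField k] [IsCMField k] {N : ℕ}
  {Φ : CMType K} {B : AbelianVariety ℂ} {ι : 𝓞 K →+* End B} {θ : K →+* Module.End ℂ (complexBetti B.X 1)}
  {Ψ : CMType k} {E : AbelianVariety ℂ} {ιE : 𝓞 k →+* End E} {θE : k →+* Module.End ℂ (complexBetti E.X 1)}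

/-- **THE HODGE CONJECTURE FOR EVERY `E^a × B^n`, `B` ANY CM FIVEFOLD OF `k`-SIGNATURE `(2,3)` OVER ANY DECIC CM FIELD
`K ⊇ i(k)`, GIVEN ONLY Markman's hyperbolic-sixfold theorem** and ONE automorphism of `ℂ` permuting the five embeddings of `K`
over `τ` CYCLICALLY (`hC5`: an enumeration `x` of the fibre with `ρ ∘ x_l = x_{l+1}` — available whenever `Aut(ℂ/k)` acts
transitively on the fibre, e.g. always for the quintic parts `C₅`, `D₅`, `F₂₀`, `A₅`, `S₅`).  `B ⊨ (K; Φ)` with two members of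
`Φ` over `τ`, `E ⊨ (k; Ψ ∋ τ)`: for every `κ : Fin N → Fin 2`, every rational `(q,q)`-class on `⨁_j ![E, B](κ j)` is algebraic.
Proof: a second `(2,3)`-type `Φ' ≠ Φ` realised by some `B'` (Shimura) only serves to put the frame in normal form; the weights of
products of `E, B` avoid its slot, and the one-type defect law under the realised `5`-cycle does the rest.
[cite: Markman2025SecantWeil, Thm 1.5.1] [cite: Shimura1998, §6.2 Thm. 3] [cite: Pohlmann1968, Thm 1] [cite: MumfordAV1970, §19] -/
theorem hodgeConjectureFor_biproduct_comp_vec₂_of_markmanD_cyclic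
    (hM6 : Markman2025_weilClasses_algebraic_hyperbolicSixfold)
    (h10 : Module.finrank ℚ K = 10) (h2 : Module.finrank ℚ k = 2) (i : k →+* K)
    (hB : IsCMTypeRealisation Φ B ι θ) (hE : IsCMTypeRealisation Ψ E ιE θE) {τ : k →+* ℂ} (hτΨ : τ ∈ Ψ.1)
    (h23 : (Finset.univ.filter fun s : K →+* ℂ => s.comp i = τ ∧ s ∈ Φ.1).card = 2)
    (hC5 : ∃ (x : Fin 5 ↪ {s : K →+* ℂ // s.comp i = τ}) (ρ : ℂ ≃+* ℂ),
      ∀ l : Fin 5, (ρ : ℂ →+* ℂ).comp (x l).1 = (x (l + 1)).1)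
    (κ : Fin N → Fin 2) :
    HodgeConjectureFor (⨁ fun j => (![E, B] : Fin 2 → AbelianVariety ℂ) (κ j)).dim
      (⨁ fun j => (![E, B] : Fin 2 → AbelianVariety ℂ) (κ j)).X := by
  have hττ : ComplexEmbedding.conjugate τ ≠ τ := QuarticCM.conjugate_ne τ
  have hk : ∀ σ : k →+* ℂ, σ = τ ∨ σ = ComplexEmbedding.conjugate τ := fun σ =>
    QuarticCM.eq_or_eq_conjugate_of_quadratic h2 τ σ
  have hΨ : ∀ σ : k →+* ℂ, σ ∈ Ψ.1 ↔ σ = τ := by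
    intro σ
    rcases hk σ with rfl | rfl
    · exact ⟨fun _ => rfl, fun _ => hτΨ⟩
    · exact ⟨fun h => absurd h ((Ψ.2 τ).1 hτΨ), fun h => absurd h hττ⟩
  -- a second `(2,3)`-type, realised (it only fixes the frame)
  obtain ⟨Φ', h23', hne⟩ := exists_cmType_ne₂₃ h10 h2 i hττ hk Φ
  obtain ⟨B', ι', θ', hB'⟩ := exists_isCMTypeRealisation Φ'
  obtain ⟨δ₀, d, hd, hδ₀⟩ := CyclicSextic.exists_sq_eq_neg_nat_of_isTotallyComplex k h2
  obtain ⟨δ, hδ, hτ⟩ := exists_delta_of_mem h2 hd hδ₀ τ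
  obtain ⟨e, c, he_sign, he_conj, hr₁, hr₂⟩ := exists_frameD h10 h2 i hττ hk Φ Φ' h23 h23' hne
  -- the realised `5`-cycle, read in the frame
  obtain ⟨x, ρ, hρ⟩ := hC5
  obtain ⟨g, -, hrot⟩ := conj_mem_realisedPerms_of_enum he_sign x (f := dihPerm 0 1) (ρ := ρ)
    fun l => by rw [dihPerm_zero_one_apply]; exact hρ l
  -- the family `Kf = (k, K)` and the three slots `(k, K, K)`
  let Kf : Fin 2 → Type := Fin.cons k fun _ : Fin 1 => K
  letI instF : ∀ j, Field (Kf j) := fun j =>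
    Fin.cases (motive := fun j => Field (Kf j)) ‹Field k› (fun _ => ‹Field K›) j
  letI instN : ∀ j, NumberField (Kf j) := fun j =>
    Fin.cases (motive := fun j => NumberField (Kf j)) ‹NumberField k› (fun _ => ‹NumberField K›) j
  haveI instC : ∀ j, IsCMField (Kf j) := fun j =>
    Fin.cases (motive := fun j => IsCMField (Kf j)) ‹IsCMField k› (fun _ => ‹IsCMField K›) j
  have hκ : ∀ j, (Fin.castSucc ∘ κ) j ≠ 2 := fun j => (Fin.castSucc_lt_last (κ j)).ne
  have hX := hodgeConjectureFor_biproduct_comp_of_frameD_of_markmanSixfold_cyclic (Kf := Kf) (i₀ := 0) (i₁ := 1) (c := c)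
    (A₃ := ![E, B, B'])
    (Φ₃ := Fin.cons Ψ (Fin.cons Φ (Fin.cons Φ' finZeroElim)))
    (ι₃ := Fin.cons ιE (Fin.cons ι (Fin.cons ι' finZeroElim)))
    (θ₃ := Fin.cons θE (Fin.cons θ (Fin.cons θ' finZeroElim))) hM6 (Fin.castSucc ∘ κ) hκ h10 h2 i hd hδ hτ
    (Fin.cases hE (Fin.cases hB (Fin.cases hB' fun l => l.elim0))) e he_sign he_conj
    (Fin.cases hr₁ (Fin.cases hr₂ fun l => l.elim0)) hΨ hrot
  -- slots `0, 1` of `(E, B, B')` are `(E, B)`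
  have hslot : ∀ y : Fin 2, (![E, B, B'] : Fin 3 → AbelianVariety ℂ) (Fin.castSucc y) =
      (![E, B] : Fin 2 → AbelianVariety ℂ) y := by
    intro y
    fin_cases y <;> rfl
  have hdom : AVDominatedBy (⨁ fun j => (![E, B] : Fin 2 → AbelianVariety ℂ) (κ j))
      (⨁ fun j => (![E, B, B'] : Fin 3 → AbelianVariety ℂ) ((Fin.castSucc ∘ κ) j)) :=
    AVDominatedBy.biproduct_map fun j => by
      rw [Function.comp_apply, hslot]
      exact AVDominatedBy.refl _
  exact Domination.hodgeConjectureFor_of_avDominatedBy hX hdom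

/-- **Everything dominated by a product of copies of `E, B`** (abelian subvarieties, quotients, isogenous varieties) satisfies
the Hodge conjecture, under the same hypotheses. [cite: Markman2025SecantWeil, Thm 1.5.1] [cite: MumfordAV1970, §19] -/
theorem hodgeConjectureFor_of_avDominatedBy_comp_vec₂_of_markmanD_cyclic
    (hM6 : Markman2025_weilClasses_algebraic_hyperbolicSixfold)
    (h10 : Module.finrank ℚ K = 10) (h2 : Module.finrank ℚ k = 2) (i : k →+* K)
    (hB : IsCMTypeRealisation Φ B ι θ) (hE : IsCMTypeRealisation Ψ E ιE θE) {τ : k →+* ℂ} (hτΨ : τ ∈ Ψ.1)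
    (h23 : (Finset.univ.filter fun s : K →+* ℂ => s.comp i = τ ∧ s ∈ Φ.1).card = 2)
    (hC5 : ∃ (x : Fin 5 ↪ {s : K →+* ℂ // s.comp i = τ}) (ρ : ℂ ≃+* ℂ),
      ∀ l : Fin 5, (ρ : ℂ →+* ℂ).comp (x l).1 = (x (l + 1)).1)
    (κ : Fin N → Fin 2) {C : AbelianVariety ℂ}
    (hC : AVDominatedBy C (⨁ fun j => (![E, B] : Fin 2 → AbelianVariety ℂ) (κ j))) :
    HodgeConjectureFor C.dim C.X :=
  Domination.hodgeConjectureFor_of_avDominatedBy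
    (hodgeConjectureFor_biproduct_comp_vec₂_of_markmanD_cyclic hM6 h10 h2 i hB hE hτΨ h23 hC5 κ) hC

end Main

/-! ## §5 The family form for ONE type -/

section Family

variable {K : Type} [Field K] [NumberField K] [IsCMField K] {k : Type} [Field k] [NumberField k] [IsCMField k]
  {n : ℕ} {Φ : Fin n → CMType K} {A : Fin n → AbelianVariety ℂ} {ι : ∀ j, 𝓞 K →+* End (A j)}
  {θ : ∀ j, K →+* Module.End ℂ (complexBetti (A j).X 1)}
  {Ψ : CMType k} {E : AbelianVariety ℂ} {ιE : 𝓞 k →+* End E} {θE : k →+* Module.End ℂ (complexBetti E.X 1)}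

/-- **THE FAMILY FORM, ONE TYPE, ANY DECIC FIELD.**  `A_j ⊨ (K; Φ_j)` (`j < n`) CM abelian fivefolds all of the SAME type
`Φ_{j₁}` of `k`-signature `(2,3)` (e.g. a CM fivefold and its Galois conjugates of the same type, any CM structures), `K ⊇ i(k)`
decic with ONE automorphism of `ℂ` permuting the five embeddings over `τ` cyclically (`hC5`), `E ⊨ (k; Ψ ∋ τ)`: every `C`
dominated by `E^a × ⨁_j A_j` satisfies the Hodge conjecture, GIVEN ONLY Markman's sixfold theorem.
[cite: Markman2025SecantWeil, Thm 1.5.1] [cite: Shimura1998, §6.1 Thm. 2 Cor.] [cite: MumfordAV1970, §19] -/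
theorem hodgeConjectureFor_of_avDominatedBy_family₁_of_markmanD_cyclic
    (hM6 : Markman2025_weilClasses_algebraic_hyperbolicSixfold)
    (h10 : Module.finrank ℚ K = 10) (h2 : Module.finrank ℚ k = 2) (i : k →+* K)
    (hA : ∀ j, IsCMTypeRealisation (Φ j) (A j) (ι j) (θ j)) {τ : k →+* ℂ} (j₁ : Fin n)
    (h23 : (Finset.univ.filter fun s : K →+* ℂ => s.comp i = τ ∧ s ∈ (Φ j₁).1).card = 2) (hpos : ∀ j, Φ j = Φ j₁)
    (hC5 : ∃ (x : Fin 5 ↪ {s : K →+* ℂ // s.comp i = τ}) (ρ : ℂ ≃+* ℂ),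
      ∀ l : Fin 5, (ρ : ℂ →+* ℂ).comp (x l).1 = (x (l + 1)).1)
    (hE : IsCMTypeRealisation Ψ E ιE θE) (hτΨ : τ ∈ Ψ.1) (a : ℕ)
    {C : AbelianVariety ℂ} (hC : AVDominatedBy C ((⨁ fun _ : Fin a => E).prod (⨁ A))) :
    HodgeConjectureFor C.dim C.X := by
  have hdomB : ∀ j, AVDominatedBy (A j) (A j₁) := fun j => avDominatedBy_of_cmType_eq (hpos j) (hA j) (hA j₁)
  let Y : Fin 2 → AbelianVariety ℂ := ![E, A j₁]
  have h₁ : AVDominatedBy (⨁ fun _ : Fin a => E) (⨁ fun _ : Fin a => Y 0) :=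
    AVDominatedBy.biproduct_map fun _ => AVDominatedBy.refl E
  have h₂ : AVDominatedBy (⨁ A) (⨁ fun _ : Fin n => Y 1) :=
    AVDominatedBy.biproduct_map fun j => hdomB j
  have h₁₂' := avDominatedBy_prod_of_biproduct h₁ h₂
  let κ' : Fin a ⊕ Fin n → Fin 2 := Sum.elim (fun _ => 0) fun _ => 1
  have hfam : sumFam (fun _ : Fin a => Y 0) (fun _ : Fin n => Y 1) = Y ∘ κ' := funext fun x => by
    cases x <;> rfl
  rw [hfam] at h₁₂'
  have hdom := avDominatedBy_biproduct_reindex finSumFinEquiv.symm h₁₂'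
  exact Domination.hodgeConjectureFor_of_avDominatedBy
    (hodgeConjectureFor_biproduct_comp_vec₂_of_markmanD_cyclic hM6 h10 h2 i (hA j₁) hE hτΨ h23 hC5 (κ' ∘ finSumFinEquiv.symm))
    (hC.trans hdom)

/-- **In particular: the Hodge conjecture for `∏_j A_j` itself** — every product of members of ONE `(2,3)`-isogeny class over ANY
decic CM field with a realised `5`-cycle (e.g. `B^n`), GIVEN ONLY Markman's sixfold theorem. [cite: Markman2025SecantWeil, Thm 1.5.1]
[cite: MumfordAV1970, §19] -/
theorem hodgeConjectureFor_biproduct_family₁_of_markmanD_cyclic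
    (hM6 : Markman2025_weilClasses_algebraic_hyperbolicSixfold)
    (h10 : Module.finrank ℚ K = 10) (h2 : Module.finrank ℚ k = 2) (i : k →+* K)
    (hA : ∀ j, IsCMTypeRealisation (Φ j) (A j) (ι j) (θ j)) {τ : k →+* ℂ} (j₁ : Fin n)
    (h23 : (Finset.univ.filter fun s : K →+* ℂ => s.comp i = τ ∧ s ∈ (Φ j₁).1).card = 2) (hpos : ∀ j, Φ j = Φ j₁)
    (hC5 : ∃ (x : Fin 5 ↪ {s : K →+* ℂ // s.comp i = τ}) (ρ : ℂ ≃+* ℂ),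
      ∀ l : Fin 5, (ρ : ℂ →+* ℂ).comp (x l).1 = (x (l + 1)).1)
    (hE : IsCMTypeRealisation Ψ E ιE θE) (hτΨ : τ ∈ Ψ.1) :
    HodgeConjectureFor (⨁ A).dim (⨁ A).X :=
  hodgeConjectureFor_of_avDominatedBy_family₁_of_markmanD_cyclic hM6 h10 h2 i hA j₁ h23 hpos hC5 hE hτΨ 0
    (C := ⨁ A) ⟨AbelianVariety.prodLift 0 (𝟙 _), AbelianVariety.snd _ _, 1, one_ne_zero, by
      rw [AbelianVariety.prodLift_snd, one_smul]⟩

end Family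

end Summit.HodgeConjecture.CorCM.DecicWeil23Pair

end
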